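import Literature.Probability.RandomPlanarGeometry.HexSAWIrreducibleWidthLaw
import HarnessLib

/-!
# The width-one strip of the hexagonal lattice: `B₁(x) = 2x²/(1 − x²)` and `B₁(x_c) = 2√2 − 2`

Topic `Literature/Probability/RandomPlanarGeometry` (continues `HexSAWStrip.lean` — the Duminil-Copin–Smirnov strip
domains `HV.stripV T L`, mid-edge walks `HV.IsMidWalk`/`HV.midWalks`, the boundary class `HV.IsBetaDart`, the
partition function `HV.stripB T L x = B_{T,L}(x)` — and `HexSAWLowerBound.lean` — `HV.stripBlim T = B_T(x_c) =
sup_L B_{T,L}(x_c)`).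

**Classification of the width-one strip** (lane «pcv-sawmu», route R53 (f); planner a-idea-1 `Sketch_G11` §R53,
`stub_R53_S5_B1`, statement verbatim): the vertices of `S_{1,L}` are the level-`0`/`1` vertices
`(x₀, 0, false)`, `(x₀, 0, true)`, on which the honeycomb lattice induces a PATH (position `2x₀ + bit`); a self-avoiding
walk from `a` therefore runs monotonically right or left, and it exits through `β` exactly at the level-`1` vertices,
after an even number `2k` of vertices, `1 ≤ k ≤ L + 1`. Hence

* `HV.stripB_one_eq : stripB 1 L x = 2 Σ_{k=1}^{L+1} x^{2k}` (exactly two width-one bridges of each even length),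
* `HV.stripBlim_one_eq : stripBlim 1 = 2√2 − 2` (`= 2x_c²/(1 − x_c²)`, `x_c² = 1/(2+√2)`), the exact value of the
  constant `B₁(x_c)` entering Duminil-Copin–Smirnov's harmonic lower bound `B_T ≥ min(B₁, x_c/c_α)/T` and the lane's
  tail bound `HV.HexIrrTailBound` (`dcsM = min(B₁, 1/(c_α x_c⁻¹)) = 2√2 − 2`, `HV.dcsM_eq`).

[cite: DuminilCopinSmirnov2012, §3 (the strip S_{T,L}, B_T; proof of Theorem 1, "B_1 > 0")]. Seat a-p1 gen 5, 2026-08-22.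
-/

noncomputable section

open Finset Filter Topology

namespace Literature.Probability.RandomPlanarGeometry.SAW

namespace HV

/-! ### The width-one strip is a path -/

/-- Position along the width-one strip: `2x₀ + bit`. [cite: DuminilCopinSmirnov2012, §3 (Fig. 3)] -/
def pos1 (v : HV) : ℤ := 2 * v.1 + bit v

/-- The level-`0`/`1` vertex at position `p`: `(p/2, 0, false)` for even `p`, `((p-1)/2, 0, true)` for odd `p`.
[cite: DuminilCopinSmirnov2012, §3 (Fig. 3)] -/
def vtx (p : ℤ) : HV := if p % 2 = 0 then (p / 2, 0, false) else (p / 2, 0, true)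

/-- `pos1 (vtx p) = p`. [cite: DuminilCopinSmirnov2012, §3 (the strip S_{T,L})] -/
theorem pos1_vtx (p : ℤ) : pos1 (vtx p) = p := by
  unfold vtx pos1
  split_ifs with h <;> simp [bit] <;> omega

/-- `(vtx p)₁ = 0`. [cite: DuminilCopinSmirnov2012, §3 (the strip S_{T,L})] -/
theorem vtx_snd (p : ℤ) : (vtx p).2.1 = 0 := by
  unfold vtx; split_ifs <;> rfl

/-- `vtx p` is of type `true` iff `p` is odd. [cite: DuminilCopinSmirnov2012, §3 (the strip S_{T,L})] -/
theorem vtx_type (p : ℤ) : (vtx p).2.2 = true ↔ p % 2 = 1 := by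
  unfold vtx; split_ifs with h <;> simp <;> omega

/-- The first coordinate of `vtx p` is `⌊p/2⌋`. [cite: DuminilCopinSmirnov2012, §3 (the strip S_{T,L})] -/
theorem vtx_fst (p : ℤ) : (vtx p).1 = p / 2 := by
  unfold vtx; split_ifs <;> rfl

/-- A level-`0`/`1` vertex is `vtx` of its position. [cite: DuminilCopinSmirnov2012, §3 (the strip S_{T,L})] -/
theorem vtx_pos1 {v : HV} (hv : v.2.1 = 0) : vtx (pos1 v) = v := by
  obtain ⟨a, b, c⟩ := v
  simp only at hv
  subst hv
  cases c
  · have h : (2 * a + 0) % 2 = 0 := by omega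
    have h2 : (2 * a + 0) / 2 = a := by omega
    simp only [pos1, bit_false, vtx, h, if_true, h2]
  · have h : ¬ (2 * a + 1) % 2 = 0 := by omega
    have h2 : (2 * a + 1) / 2 = a := by omega
    simp only [pos1, bit_true, vtx, h, if_false, h2]

/-- Level-`0`/`1` vertices with the same position coincide. [cite: DuminilCopinSmirnov2012, §3 (the strip S_{T,L})] -/
theorem eq_of_pos1_eq {v w : HV} (hv : v.2.1 = 0) (hw : w.2.1 = 0) (h : pos1 v = pos1 w) : v = w := by
  rw [← vtx_pos1 hv, ← vtx_pos1 hw, h]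

/-- `vtx 0 = O`. [cite: DuminilCopinSmirnov2012, §3 (the strip S_{T,L})] -/
@[simp] theorem vtx_zero : vtx 0 = hvOrigin := by
  simp [vtx, hvOrigin]

/-- Consecutive positions are adjacent. [cite: DuminilCopinSmirnov2012, §3 (Fig. 3)] -/
theorem adj_vtx_succ (p : ℤ) : hvGraph.Adj (vtx p) (vtx (p + 1)) := by
  rw [hvGraph_adj]
  unfold vtx AdjRel
  rcases Int.emod_two_eq_zero_or_one p with h | h
  · have h' : ¬ (p + 1) % 2 = 0 := by omega
    simp only [h, h', if_true, if_false]
    simp only [true_and, and_true]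
    left; left; omega
  · have h0 : ¬ p % 2 = 0 := by omega
    have h' : (p + 1) % 2 = 0 := by omega
    simp only [h0, h', if_true, if_false]
    simp only [true_and, and_true]
    right; right; left; omega

/-- … and so are positions `p` and `p - 1`. [cite: DuminilCopinSmirnov2012, §3 (Fig. 3)] -/
theorem adj_vtx_pred (p : ℤ) : hvGraph.Adj (vtx p) (vtx (p - 1)) := by
  have := adj_vtx_succ (p - 1)
  rw [sub_add_cancel] at this
  exact this.symm

/-- A level-`1` vertex exits the strip upwards through `β`: `vtx p ~ ((vtx p).1, 1, false)` for odd `p`.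
[cite: DuminilCopinSmirnov2012, §3 (β)] -/
theorem adj_vtx_exit {p : ℤ} (hp : p % 2 = 1) : hvGraph.Adj (vtx p) ((vtx p).1, 1, false) := by
  rw [hvGraph_adj]
  unfold vtx AdjRel
  have h0 : ¬ p % 2 = 0 := by omega
  simp only [h0, if_false]
  simp

/-- Inside the width-one strip every edge moves the position by `±1`. [cite: DuminilCopinSmirnov2012, §3 (Fig. 3)] -/
theorem pos1_step {v w : HV} (hv : v.2.1 = 0) (hw : w.2.1 = 0) (h : hvGraph.Adj v w) :
    pos1 w = pos1 v + 1 ∨ pos1 w = pos1 v - 1 := by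
  obtain ⟨a, b, c⟩ := v
  obtain ⟨a', b', c'⟩ := w
  simp only at hv hw
  subst hv; subst hw
  rw [hvGraph_adj] at h
  cases c <;> cases c' <;> simp [AdjRel] at h <;> simp [pos1] <;> omega

/-- Vertices of `S_{1,L}`: the level-`0`/`1` vertices `(x₀, 0, b)` with `-L - b ≤ x₀ ≤ L`.
[cite: DuminilCopinSmirnov2012, §3 (S_{T,L})] -/
theorem mem_stripV_one_iff {L : ℕ} {v : HV} :
    v ∈ stripV 1 L ↔ v.2.1 = 0 ∧ -(L : ℤ) - bit v ≤ v.1 ∧ v.1 ≤ L := by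
  rw [mem_stripV_iff]
  obtain ⟨a, b, c⟩ := v
  cases c <;> simp [bit] <;> omega

/-! ### A self-avoiding nearest-neighbour path on `ℤ` from `0` is monotone -/

/-- If `f 0 = 0`, consecutive values differ by `±1`, and `f` is injective on `[0, n]`, then `f i = f 1 · i`
for all `i ≤ n`. [cite: DuminilCopinSmirnov2012, §3 (the strip S_{T,L})] -/
theorem eq_mul_of_unit_steps {f : ℕ → ℤ} {n : ℕ} (h0 : f 0 = 0)
    (hstep : ∀ i, i + 1 ≤ n → f (i + 1) = f i + 1 ∨ f (i + 1) = f i - 1)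
    (hinj : ∀ i j, i ≤ n → j ≤ n → f i = f j → i = j) :
    ∀ i, i ≤ n → f i = f 1 * i := by
  intro i
  induction i using Nat.strong_induction_on with
  | _ i ih =>
    intro hi
    match i, ih, hi with
    | 0, _, _ => simp [h0]
    | 1, _, _ => simp
    | i + 2, ih, hi =>
      have h1 := ih (i + 1) (by omega) (by omega)
      have h2 := ih i (by omega) (by omega)
      have hs : f 1 = 1 ∨ f 1 = -1 := by
        have := hstep 0 (by omega)
        rw [zero_add, h0] at this
        simpa using this
      have hne : f (i + 2) ≠ f i := fun heq => by
        have := hinj (i + 2) i hi (by omega) heq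
        omega
      have h := hstep (i + 1) hi
      rw [show i + 1 + 1 = i + 2 by ring] at h
      rcases hs with hs | hs <;> (rw [hs] at h1 h2 ⊢; push_cast at h1 h2 h ⊢; omega)

/-- `bit (vtx p) = p mod 2`. [cite: DuminilCopinSmirnov2012, §3 (the strip S_{T,L})] -/
theorem bit_vtx (p : ℤ) : bit (vtx p) = p % 2 := by
  unfold vtx
  split_ifs with h <;> simp [bit] <;> omega

/-! ### The zigWalk-zag walks of the width-one strip -/

/-- The inner vertices of the zigWalk-zag walk of direction `s = ±1` and `n` vertices: positions `0, s, …, (n-1)s`.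
[cite: DuminilCopinSmirnov2012, §3 (Fig. 3)] -/
def zigInner (s : ℤ) (n : ℕ) : List HV := (List.range n).map fun i : ℕ => vtx (s * (i : ℤ))

/-- The exit vertex above a level-`1` vertex (the head of its `β` dart). [cite: DuminilCopinSmirnov2012, §3 (β)] -/
def exitV (v : HV) : HV := (v.1, 1, false)

/-- The zigWalk-zag mid-edge walk with `2k` inner vertices: `w`, the positions `0, s, …, (2k-1)s`, then the exit through
`β`. [cite: DuminilCopinSmirnov2012, §3] -/
def zigWalk (s : ℤ) (k : ℕ) : List HV :=
  wOut :: (zigInner s (2 * k) ++ [exitV (vtx (s * (2 * (k : ℤ) - 1)))])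

/-- `zigInner` has `n` entries. [cite: DuminilCopinSmirnov2012, §3 (the strip S_{T,L})] -/
@[simp] theorem length_zigInner (s : ℤ) (n : ℕ) : (zigInner s n).length = n := by simp [zigInner]

/-- The entries of `zigInner`. [cite: DuminilCopinSmirnov2012, §3 (the strip S_{T,L})] -/
theorem getElem_zigInner (s : ℤ) (n : ℕ) {i : ℕ} (hi : i < (zigInner s n).length) :
    (zigInner s n)[i] = vtx (s * i) := by
  simp [zigInner]

/-- Membership in `zigInner`. [cite: DuminilCopinSmirnov2012, §3 (the strip S_{T,L})] -/
theorem mem_zigInner {s : ℤ} {n : ℕ} {x : HV} : x ∈ zigInner s n ↔ ∃ i < n, x = vtx (s * i) := by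
  simp only [zigInner, List.mem_map, List.mem_range]
  constructor
  · rintro ⟨i, hi, rfl⟩; exact ⟨i, hi, rfl⟩
  · rintro ⟨i, hi, rfl⟩; exact ⟨i, hi, rfl⟩

/-- `zigInner s (n+1) = O :: …`. [cite: DuminilCopinSmirnov2012, §3 (the strip S_{T,L})] -/
theorem zigInner_succ (s : ℤ) (n : ℕ) :
    zigInner s (n + 1) = hvOrigin :: (List.range n).map fun i : ℕ => vtx (s * ((i : ℤ) + 1)) := by
  rw [zigInner, List.range_succ_eq_map, List.map_cons, List.map_map]
  simp [Function.comp_def, Nat.cast_succ]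

/-- `zigInner` is a chain for `s = ±1`. [cite: DuminilCopinSmirnov2012, §3 (Fig. 3)] -/
theorem isChain_zigInner {s : ℤ} (hs : s = 1 ∨ s = -1) (n : ℕ) : (zigInner s n).IsChain hvGraph.Adj := by
  rw [List.isChain_iff_getElem]
  intro i hi
  rw [getElem_zigInner, getElem_zigInner]
  push_cast
  rcases hs with rfl | rfl
  · rw [one_mul, one_mul]; exact adj_vtx_succ _
  · rw [neg_one_mul, neg_one_mul, neg_add, ← sub_eq_add_neg]; exact adj_vtx_pred _

/-- `zigInner` has no repeated vertex (`s ≠ 0`). [cite: DuminilCopinSmirnov2012, §3 (the strip S_{T,L})] -/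
theorem nodup_zigInner {s : ℤ} (hs : s ≠ 0) (n : ℕ) : (zigInner s n).Nodup := by
  refine (List.nodup_range).map fun i j hij => ?_
  have := congrArg pos1 hij
  simp only [pos1_vtx] at this
  exact_mod_cast mul_left_cancel₀ hs this

/-- The inner vertices of the zigWalk-zag stay in `S_{1,L}` as long as `n ≤ 2L + 2`. [cite: DuminilCopinSmirnov2012, §3] -/
theorem zigInner_subset_stripV {s : ℤ} (hs : s = 1 ∨ s = -1) {n L : ℕ} (hn : n ≤ 2 * L + 2) :
    ∀ x ∈ zigInner s n, x ∈ stripV 1 L := by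
  intro x hx
  obtain ⟨i, hi, rfl⟩ := mem_zigInner.1 hx
  rw [mem_stripV_one_iff, vtx_snd, bit_vtx, vtx_fst]
  have hi' : (i : ℤ) ≤ 2 * L + 1 := by exact_mod_cast (by omega : i ≤ 2 * L + 1)
  rcases hs with rfl | rfl <;> refine ⟨rfl, ?_, ?_⟩ <;> omega

/-- The zigWalk-zag walk with `2k` vertices, `1 ≤ k ≤ L+1`, is a self-avoiding mid-edge walk of `S_{1,L}` ending on
`β`, of length `ℓ = 2k`. [cite: DuminilCopinSmirnov2012, §3] -/
theorem zigWalk_mem {s : ℤ} (hs : s = 1 ∨ s = -1) {k L : ℕ} (hk : 1 ≤ k) (hkL : k ≤ L + 1) :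
    zigWalk s k ∈ (midWalks (stripV 1 L)).filter fun P => IsBetaDart 1 (finalDart P) := by
  have hs0 : s ≠ 0 := by rcases hs with rfl | rfl <;> norm_num
  set n := 2 * k with hn
  set p : ℤ := s * (2 * (k : ℤ) - 1) with hp
  have hpodd : p % 2 = 1 := by rcases hs with rfl | rfl <;> (rw [hp]; omega)
  set e := exitV (vtx p) with he
  -- the last inner vertex
  have hlast : (zigInner s n).getLast? = some (vtx p) := by
    rw [List.getLast?_eq_getElem?, length_zigInner, List.getElem?_eq_getElem (by rw [length_zigInner]; omega),
      getElem_zigInner]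
    congr 2
    rw [hp, hn]
    rw [show ((2 * k - 1 : ℕ) : ℤ) = 2 * (k : ℤ) - 1 by push_cast [Nat.cast_sub (by omega : 1 ≤ 2 * k)]; ring]
  have hhead : (zigInner s n ++ [e]).head? = some hvOrigin := by
    rw [hn, show 2 * k = (2 * k - 1) + 1 by omega, zigInner_succ]; rfl
  have hne : zigInner s n ≠ [] := by
    intro h; have := congrArg List.length h; simp [hn] at this; omega
  rw [mem_filter, mem_midWalks_iff]
  refine ⟨⟨?_, rfl, hhead, ?_, ?_, ?_⟩, ?_⟩
  · -- chain
    rw [zigWalk, List.isChain_cons]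
    refine ⟨fun y hy => ?_, ?_⟩
    · rw [hhead] at hy
      simp only [Option.mem_def, Option.some.injEq] at hy
      subst hy
      exact adj_wOut_hvOrigin
    · rw [List.isChain_append]
      refine ⟨isChain_zigInner hs n, List.isChain_singleton _, fun x hx y hy => ?_⟩
      rw [hlast] at hx
      simp only [Option.mem_def, Option.some.injEq, List.head?_cons] at hx hy
      subst hx; subst hy
      exact adj_vtx_exit hpodd
  · -- inner vertices in the strip
    intro x hx
    rw [zigWalk, inner_cons, List.dropLast_concat] at hx   -- hmm name
    exact zigInner_subset_stripV hs (by omega) x hx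
  · -- nodup
    rw [zigWalk, inner_cons, List.dropLast_concat]
    exact nodup_zigInner hs0 n
  · -- the final half-edge does not retrace
    rw [zigWalk]
    intro h
    have h1 : (wOut :: (zigInner s n ++ [e])).getLast? = some e := by
      rw [← List.cons_append, List.getLast?_concat]
    rw [h1, List.dropLast_cons_of_ne_nil (by simp), List.dropLast_concat] at h
    -- some member of `w :: zigInner` (dropLast) equals `e`, but their second coordinates are ≤ 0
    have hmem : e ∈ (wOut :: zigInner s n).dropLast := List.mem_of_mem_getLast? h
    have hmem' : e ∈ wOut :: zigInner s n := List.mem_of_mem_dropLast hmem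
    have he2 : e.2.1 = 1 := by rw [he]; rfl
    rcases List.mem_cons.1 hmem' with h2 | h2
    · rw [h2] at he2
      exact absurd he2 (by decide)
    · obtain ⟨i, -, hi⟩ := mem_zigInner.1 h2
      rw [hi, vtx_snd] at he2
      exact absurd he2 (by norm_num)
  · -- the final dart is on `β`
    have hfd : finalDart (zigWalk s k) = (vtx p, e) := by
      rw [finalDart, zigWalk]
      have h1 : (wOut :: (zigInner s n ++ [e])).getLast? = some e := by
        rw [← List.cons_append, List.getLast?_concat]
      obtain ⟨ys, hys⟩ := List.getLast?_eq_some_iff.1 hlast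
      have h2 : (wOut :: zigInner s n).getLast? = some (vtx p) := by
        rw [hys, ← List.cons_append, List.getLast?_concat]
      rw [h1, List.dropLast_cons_of_ne_nil (by simp), List.dropLast_concat, h2]
      rfl
    rw [hfd]
    refine ⟨?_, (vtx_type p).2 hpodd, ?_⟩
    · rw [vtx_snd]; norm_num
    · simp [he, exitV, vtx_snd]

/-- The zigWalk-zag walk with `2k` vertices has `ℓ = 2k`. [cite: DuminilCopinSmirnov2012, §3 (the strip S_{T,L})] -/
theorem mwLen_zigWalk (s : ℤ) (k : ℕ) : mwLen (zigWalk s k) = 2 * k := by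
  simp [mwLen, zigWalk]

/-! ### Classification of the `β`-walks of the width-one strip -/

/-- **Every self-avoiding mid-edge walk of `S_{1,L}` ending on `β` is a zig-zag walk**: its inner vertices run
monotonically along the path (a self-avoiding nearest-neighbour path on `ℤ` from `0` is monotone), the exit vertex
is of type `1`, so the number of vertices is even, `2k` with `1 ≤ k ≤ L+1`.
[cite: DuminilCopinSmirnov2012, §3 (S_{T,L}, β)] -/
theorem exists_eq_zigWalk {L : ℕ} {P : List HV}
    (hP : P ∈ (midWalks (stripV 1 L)).filter fun P => IsBetaDart 1 (finalDart P)) :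
    ∃ s : ℤ, (s = 1 ∨ s = -1) ∧ ∃ k : ℕ, 1 ≤ k ∧ k ≤ L + 1 ∧ P = zigWalk s k := by
  rw [mem_filter, mem_midWalks_iff] at hP
  obtain ⟨hmw, hβ⟩ := hP
  obtain ⟨Q, rfl⟩ := hmw.exists_eq_cons
  obtain ⟨hchain, -, -, hV, hnodup, -⟩ := hmw
  -- the trivial walk `[w, O]` does not end on `β`
  rcases eq_or_ne Q [] with rfl | hQ
  · simp [finalDart, IsBetaDart, wOut] at hβ
  -- `R = O :: Q = I ++ [u]`, `I = inner P`
  have hRne : (hvOrigin :: Q) ≠ [] := List.cons_ne_nil _ _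
  set I : List HV := (hvOrigin :: Q).dropLast with hI
  set u : HV := (hvOrigin :: Q).getLast hRne with hu
  have hRsplit : hvOrigin :: Q = I ++ [u] := (List.dropLast_append_getLast hRne).symm
  have hIeq : I = hvOrigin :: Q.dropLast := by rw [hI, List.dropLast_cons_of_ne_nil hQ]
  have hIne : I ≠ [] := by rw [hIeq]; exact List.cons_ne_nil _ _
  set m := I.length with hm
  have hm1 : 1 ≤ m := by rw [hm, hIeq]; simp
  have hI0 : I[0]'(by omega) = hvOrigin := by simp [hIeq]
  -- inner vertices, chain, nodup
  have hinner : inner (wOut :: hvOrigin :: Q) = I := rfl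
  rw [hinner] at hV hnodup
  have hx1 : ∀ i (hi : i < m), (I[i]).2.1 = 0 := fun i hi =>
    (mem_stripV_one_iff.1 (hV _ (List.getElem_mem hi))).1
  have hchainR : (I ++ [u]).IsChain hvGraph.Adj := by
    rw [← hRsplit]; exact (List.isChain_cons.1 hchain).2
  have hchainI : ∀ i (hi : i + 1 < m), hvGraph.Adj (I[i]) (I[i + 1]) := by
    have := (List.isChain_append.1 hchainR).1
    rw [List.isChain_iff_getElem] at this
    exact this
  -- the final dart `(I.getLast, u)`
  have hlastI : I.getLast hIne = I[m - 1]'(by omega) := List.getLast_eq_getElem hIne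
  have hfd : finalDart (wOut :: hvOrigin :: Q) = (I[m - 1]'(by omega), u) := by
    rw [finalDart, hRsplit]
    have h1 : (wOut :: (I ++ [u])).getLast? = some u := by rw [← List.cons_append, List.getLast?_concat]
    obtain ⟨ys, hys⟩ := List.getLast?_eq_some_iff.1 (List.getLast?_eq_some_getLast hIne)
    have h2 : (wOut :: I).getLast? = some (I.getLast hIne) := by
      have e : wOut :: I = (wOut :: ys) ++ [I.getLast hIne] := by
        rw [List.cons_append]; exact congrArg (wOut :: ·) hys
      rw [e, List.getLast?_concat]
    rw [h1, List.dropLast_cons_of_ne_nil (by simp), List.dropLast_concat, h2, hlastI]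
    rfl
  rw [hfd] at hβ
  obtain ⟨-, htype, hu_eq⟩ := hβ
  simp only at htype hu_eq
  -- the positions: `pos1 I[i] = s i`
  set f : ℕ → ℤ := fun i => if h : i < m then pos1 (I[i]) else 0 with hf
  have hfval : ∀ i (hi : i < m), f i = pos1 (I[i]) := fun i hi => by simp [hf, hi]
  have hf0 : f 0 = 0 := by rw [hfval 0 (by omega), hI0]; rfl
  have hfstep : ∀ i, i + 1 ≤ m - 1 → f (i + 1) = f i + 1 ∨ f (i + 1) = f i - 1 := by
    intro i hi
    rw [hfval i (by omega), hfval (i + 1) (by omega)]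
    exact pos1_step (hx1 i (by omega)) (hx1 (i + 1) (by omega)) (hchainI i (by omega))
  have hfinj : ∀ i j, i ≤ m - 1 → j ≤ m - 1 → f i = f j → i = j := by
    intro i j hi hj hij
    rw [hfval i (by omega), hfval j (by omega)] at hij
    have := eq_of_pos1_eq (hx1 i (by omega)) (hx1 j (by omega)) hij
    exact (List.Nodup.getElem_inj_iff hnodup).1 this
  have hlin := eq_mul_of_unit_steps hf0 hfstep hfinj
  -- `m ≥ 2`: the last inner vertex has type `1`, `O` has type `0`
  have hm2 : 2 ≤ m := by
    by_contra hlt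
    have hm1' : m = 1 := by omega
    have : I[m - 1]'(by omega) = hvOrigin := by simp only [hm1', Nat.sub_self]; exact hI0
    rw [this] at htype
    exact absurd htype (by decide)
  set σ : ℤ := f 1 with hσ
  have hσ1 : σ = 1 ∨ σ = -1 := by
    have := hfstep 0 (by omega)
    rw [zero_add, hf0] at this
    simpa using this
  have hIi : ∀ i (hi : i < m), I[i] = vtx (σ * i) := fun i hi => by
    rw [← vtx_pos1 (hx1 i hi), ← hfval i hi, hlin i (by omega)]
  have hIzig : I = zigInner σ m := by
    refine List.ext_getElem (by simp [hm]) fun i h1 h2 => ?_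
    rw [hIi i h1, getElem_zigInner]
  -- `m = 2k`
  have hlast_vtx : I[m - 1]'(by omega) = vtx (σ * ((m : ℤ) - 1)) := by
    rw [hIi (m - 1) (by omega)]; push_cast [Nat.cast_sub hm1]; ring_nf
  have hodd : (σ * ((m : ℤ) - 1)) % 2 = 1 := by
    rw [hlast_vtx, vtx_type] at htype; exact htype
  obtain ⟨k, hk⟩ : ∃ k, m = 2 * k := ⟨m / 2, by rcases hσ1 with h | h <;> (rw [h] at hodd; omega)⟩
  have hk1 : 1 ≤ k := by omega
  -- `k ≤ L + 1` from the last vertex being in the strip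
  have hkL : k ≤ L + 1 := by
    have hmem := mem_stripV_one_iff.1 (hV _ (List.getElem_mem (by omega : m - 1 < m)))
    rw [hlast_vtx, bit_vtx, vtx_fst] at hmem
    obtain ⟨-, hlo, hhi⟩ := hmem
    rw [hk] at hlo hhi
    push_cast at hlo hhi
    rcases hσ1 with h | h <;> (rw [h] at hlo hhi; omega)
  refine ⟨σ, hσ1, k, hk1, hkL, ?_⟩
  -- assemble
  rw [zigWalk, hRsplit, hIzig, hu_eq, hlast_vtx, hk]
  have e1 : σ * (((2 * k : ℕ) : ℤ) - 1) = σ * (2 * (k : ℤ) - 1) := by push_cast; ring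
  rw [e1]
  simp [exitV, vtx_snd]

/-! ### `B_{1,L}(x) = 2 Σ_{k=1}^{L+1} x^{2k}` -/

/-- The length of a zig-zag walk list. [cite: DuminilCopinSmirnov2012, §3 (the strip S_{T,L})] -/
theorem length_zigWalk (s : ℤ) (k : ℕ) : (zigWalk s k).length = 2 * k + 2 := by
  simp [zigWalk]

/-- The second inner vertex of a zig-zag walk reads off its direction. [cite: DuminilCopinSmirnov2012, §3 (the strip S_{T,L})] -/
theorem zigWalk_getElem_two {s : ℤ} {k : ℕ} (hk : 1 ≤ k) (h : 2 < (zigWalk s k).length) :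
    (zigWalk s k)[2] = vtx s := by
  have h1 : 1 < (zigInner s (2 * k)).length := by rw [length_zigInner]; omega
  simp only [zigWalk, List.getElem_cons_succ]
  rw [List.getElem_append_left h1, getElem_zigInner]
  simp

/-- The zig-zag walks with different data are different lists. [cite: DuminilCopinSmirnov2012, §3 (the strip S_{T,L})] -/
theorem zigWalk_injOn (L : ℕ) :
    Set.InjOn (fun q : ℤ × ℕ => zigWalk q.1 q.2) ↑((({1, -1} : Finset ℤ)) ×ˢ Icc 1 (L + 1)) := by
  rintro ⟨s, k⟩ hq ⟨s', k'⟩ hq' h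
  simp only [coe_product, Set.mem_prod, mem_coe, mem_Icc] at hq hq'
  simp only at h
  have hk : k = k' := by
    have := congrArg List.length h
    rw [length_zigWalk, length_zigWalk] at this
    omega
  subst hk
  have h2 : (zigWalk s k)[2]'(by rw [length_zigWalk]; omega) = (zigWalk s' k)[2]'(by rw [length_zigWalk]; omega) := by
    simp only [h]
  rw [zigWalk_getElem_two hq.2.1, zigWalk_getElem_two hq'.2.1] at h2
  have := congrArg pos1 h2
  rw [pos1_vtx, pos1_vtx] at this
  rw [this]

/-- **The `β`-walks of `S_{1,L}` are exactly the zig-zag walks** `zigWalk s k`, `s = ±1`, `1 ≤ k ≤ L + 1`.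
[cite: DuminilCopinSmirnov2012, §3] -/
theorem filter_isBetaDart_one_eq_image (L : ℕ) :
    (midWalks (stripV 1 L)).filter (fun P => IsBetaDart 1 (finalDart P)) =
      ((({1, -1} : Finset ℤ)) ×ˢ Icc 1 (L + 1)).image fun q => zigWalk q.1 q.2 := by
  ext P
  constructor
  · intro hP
    obtain ⟨s, hs, k, hk1, hkL, rfl⟩ := exists_eq_zigWalk hP
    refine mem_image.2 ⟨(s, k), mem_product.2 ⟨?_, mem_Icc.2 ⟨hk1, hkL⟩⟩, rfl⟩
    rcases hs with rfl | rfl <;> simp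
  · intro hP
    obtain ⟨⟨s, k⟩, hq, rfl⟩ := mem_image.1 hP
    rw [mem_product, mem_Icc] at hq
    obtain ⟨hs, hk1, hkL⟩ := hq
    have hs' : s = 1 ∨ s = -1 := by simpa using hs
    exact zigWalk_mem hs' hk1 hkL

/-- **`B_{1,L}(x) = 2 Σ_{k=1}^{L+1} x^{2k}`**: exactly two width-one bridges of each even length `2k ≤ 2L + 2`, none
of odd length. [cite: DuminilCopinSmirnov2012, §3 (B_{T,L})] -/
theorem stripB_one_eq (L : ℕ) (x : ℝ) : stripB 1 L x = 2 * ∑ k ∈ Icc 1 (L + 1), x ^ (2 * k) := by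
  rw [stripB, filter_isBetaDart_one_eq_image, sum_image (zigWalk_injOn L), sum_product]
  simp only [mwLen_zigWalk]
  rw [sum_pair (by norm_num : (1 : ℤ) ≠ -1)]
  ring

/-! ### `B₁(x_c) = 2√2 − 2` -/

/-- `Σ_{k=1}^{n} q^k + 1 = Σ_{k<n+1} q^k`. [folklore] -/
private theorem sum_Icc_pow_add_one (q : ℝ) (n : ℕ) :
    ∑ k ∈ Icc 1 n, q ^ k + 1 = ∑ k ∈ range (n + 1), q ^ k := by
  induction n with
  | zero => simp
  | succ n ih => rw [sum_Icc_succ_top (by omega), sum_range_succ, ← ih]; ring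

/-- **`B₁(x_c) = 2√2 − 2`** (planner statement `stub_R53_S5_B1`, verbatim): the sup over `L` of
`B_{1,L}(x_c) = 2 Σ_{k ≤ L+1} x_c^{2k}` is the geometric series `2x_c²/(1 − x_c²) = 2/(1 + √2) = 2√2 − 2`.
[cite: DuminilCopinSmirnov2012, §3 (B_T; proof of Theorem 1)] -/
theorem stripBlim_one_eq : stripBlim 1 = 2 * Real.sqrt 2 - 2 := by
  obtain ⟨hxc0, hxc1⟩ := hexCriticalFugacity_pos_lt_one
  set q : ℝ := hexCriticalFugacity ^ 2 with hq
  have hq0 : 0 ≤ q := by positivity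
  have hq1 : q < 1 := by rw [hq]; nlinarith
  have h1q : 0 < 1 - q := by linarith
  -- the value of the geometric series
  have hval : 2 * q / (1 - q) = 2 * Real.sqrt 2 - 2 := by
    have hs2 : Real.sqrt 2 ^ 2 = 2 := Real.sq_sqrt (by norm_num)
    have hs0 : 0 ≤ Real.sqrt 2 := Real.sqrt_nonneg 2
    have hq' : q = (2 + Real.sqrt 2)⁻¹ := by
      rw [hq, hexCriticalFugacity, inv_pow, Real.sq_sqrt (by positivity)]
    rw [hq', div_eq_iff (by rw [← hq']; exact h1q.ne')]
    field_simp
    nlinarith [hs2, hs0]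
  -- the partial sums
  have hg : ∀ L : ℕ, stripB 1 L hexCriticalFugacity = 2 * ((∑ k ∈ range (L + 2), q ^ k) - 1) := by
    intro L
    rw [stripB_one_eq, show L + 2 = (L + 1) + 1 by ring, ← sum_Icc_pow_add_one, add_sub_cancel_right]
    congr 1
    refine sum_congr rfl fun k _ => ?_
    rw [hq, ← pow_mul]
  have hmono : Monotone fun L : ℕ => stripB 1 L hexCriticalFugacity :=
    fun a b hab => stripB_mono_L hxc0.le hab
  have htend : Tendsto (fun L : ℕ => stripB 1 L hexCriticalFugacity) atTop (𝓝 (2 * q / (1 - q))) := by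
    have hgeo := (hasSum_geometric_of_lt_one hq0 hq1).tendsto_sum_nat
    have h2 := (hgeo.comp (tendsto_add_atTop_nat 2))
    have h3 : Tendsto (fun L : ℕ => 2 * ((∑ k ∈ range (L + 2), q ^ k) - 1)) atTop
        (𝓝 (2 * ((1 - q)⁻¹ - 1))) := (h2.sub_const 1).const_mul 2
    have hlim : 2 * ((1 - q)⁻¹ - 1) = 2 * q / (1 - q) := by field_simp; ring
    rw [← hlim]
    refine h3.congr fun L => ?_
    exact (hg L).symm
  have hsup := tendsto_atTop_ciSup hmono (bddAbove_stripB DuminilCopinSmirnov2012_lemma2_holds le_rfl)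
  rw [← hval]
  exact tendsto_nhds_unique hsup htend

/-- `√2 − 1 ≤ x_c` (`x_c = 0.5412`, `√2 − 1 = 0.4142`). [cite: DuminilCopinSmirnov2012, §1] -/
theorem sqrt_two_sub_one_le_hexCriticalFugacity : Real.sqrt 2 - 1 ≤ hexCriticalFugacity := by
  have hs2 : Real.sqrt 2 ^ 2 = 2 := Real.sq_sqrt (by norm_num)
  have hs0 : 0 ≤ Real.sqrt 2 := Real.sqrt_nonneg 2
  have hs1 : 1 ≤ Real.sqrt 2 := by nlinarith
  set t := Real.sqrt (2 + Real.sqrt 2) with ht_def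
  have ht : t ^ 2 = 2 + Real.sqrt 2 := Real.sq_sqrt (by positivity)
  have ht0 : 0 < t := Real.sqrt_pos.2 (by positivity)
  rw [hexCriticalFugacity, ← ht_def, ← one_div, le_div_iff₀ ht0]
  -- `((√2 - 1) t)² = 2 - √2 ≤ 1`
  have hu0 : 0 ≤ (Real.sqrt 2 - 1) * t := mul_nonneg (by linarith) ht0.le
  have hu2 : ((Real.sqrt 2 - 1) * t) ^ 2 = 2 - Real.sqrt 2 := by
    have : ((Real.sqrt 2 - 1) * t) ^ 2 = (Real.sqrt 2 ^ 2 - 2 * Real.sqrt 2 + 1) * t ^ 2 := by ring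
    rw [this, ht, hs2]
    nlinarith [hs2]
  nlinarith [hu2, hu0]

/-- **The Duminil-Copin–Smirnov constant of the harmonic lower bound is `2√2 − 2`**:
`dcsM = min(B₁(x_c), x_c/cos(3π/8)) = min(2√2 − 2, √2) = 2√2 − 2` (corollary of `stripBlim_one_eq`; the
second entry is `≥ 2x_c ≥ 2√2 − 2` since `cos(3π/8) ≤ 1/2`). [cite: DuminilCopinSmirnov2012, §3 (proof of Theorem 1)] -/
theorem dcsM_eq : dcsM = 2 * Real.sqrt 2 - 2 := by
  rw [dcsM, stripBlim_one_eq, min_eq_left]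
  have hc0 := cos_three_pi_div_eight_pos
  have hc : Real.cos (3 * Real.pi / 8) ≤ 1 / 2 := by
    rw [← Real.cos_pi_div_three]
    exact Real.cos_le_cos_of_nonneg_of_le_pi (by positivity) (by linarith [Real.pi_pos])
      (by linarith [Real.pi_pos])
  obtain ⟨hx0, -⟩ := hexCriticalFugacity_pos_lt_one
  have hxc := sqrt_two_sub_one_le_hexCriticalFugacity
  rw [mul_inv, inv_inv]
  calc 2 * Real.sqrt 2 - 2 ≤ 2 * hexCriticalFugacity := by linarith
    _ = (1 / 2)⁻¹ * hexCriticalFugacity := by norm_num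
    _ ≤ (Real.cos (3 * Real.pi / 8))⁻¹ * hexCriticalFugacity :=
        mul_le_mul_of_nonneg_right ((inv_le_inv₀ (by norm_num) hc0).2 hc) hx0.le

/-- **The explicit tail of the critical irreducible-bridge width law with the SHARP constant**:
`P(width > T) ≤ 1/(1 + (2√2 − 2)·ln(T+1))` for `T ≥ 1` (tree `HV.irrTail_le_inv_log` with `dcsM = 2√2 − 2 = 0.8284`
from `dcsM_eq`; compare the numeric corollary with `1/(2+√2) = 0.2929` in `HexSAWIrreducibleWidthLaw`).
[cite: DuminilCopinSmirnov2012, §3 (proof of Theorem 1)]; [cite: MadrasSlade1993, Appendix B, eq. (B.5)] -/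
theorem irrTail_le_inv_log_sharp (T : ℕ) (hT : 1 ≤ T) :
    irrTail T ≤ 1 / (1 + (2 * Real.sqrt 2 - 2) * Real.log ((T : ℝ) + 1)) := by
  rw [← dcsM_eq]
  exact irrTail_le_inv_log T hT

end HV

end Literature.Probability.RandomPlanarGeometry.SAW

end
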